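import Literature.AnabelianGeometry.EtaleTheta.Discharge.Sec1ZNUniquenessOfKummer
import Literature.AnabelianGeometry.EtaleTheta.Discharge.Sec1CuspInertiaTateTwist
import Literature.AnabelianGeometry.EtaleTheta.Discharge.Sec2DtpYThetaAbelian
import Literature.AnabelianGeometry.EtaleTheta.Discharge.Sec1CompatOfSetting
import Literature.AnabelianGeometry.EtaleTheta.ThetaSettingTopology
import HarnessLib

/-!
# [EtTh] §1 p. 14: the central-kernel clause `hcen` AT THE ROOT from the origin predicates — hence the origin clause
# `GtpZNFromSplitting` (∀-form) is a theorem of print's DEFINITION of `Z_N` at every joint origin (proof-only)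

Mochizuki, *The étale theta function and its Frobenioid-theoretic manifestations*, Publ. RIMS **45** (2009) [EtTh], §1
p. 14: «`1 → Δ_Θ ⊗ ℤ/Nℤ (≅ ℤ/Nℤ(1)) → (Π^tp_{Y_N})^Θ/N·(Δ^tp_Y)^Θ → G_{K_N} → 1` … [by the definition of `J_N`] … all
splittings of this exact sequence determine the same splitting over `G_{J_N}`» [cite: MochizukiEtTh2009, §1 p.14]; p. 12
«abelian profinite groups `1 → Δ_Θ → (Δ^tp_Y)^Θ → (Δ^tp_Y)^ell → 1`», «`(Ẑ(1) ≅) Δ_Θ`»; p. 16 «`Δ^tp_Y/Δ^tp_{Y_N} ≅ ℤ/Nℤ(1)`».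
abc-iut cell, layer L2, seat abc-iut-w5-d062 (gen 5); sequel of this seat's ROOT uniqueness theorem
(`Discharge/Sec1ZNUniquenessOfKummer`, p470538; abc-iut-L2-t1's successor row (a) «hcen at the root ⟸ a Θ-level Tate
clause»).  PROOF-ONLY: no definition, no new named fact.

WHAT.  The only structural binder of the root uniqueness theorem, `hcen` («`Π^tp_{Y_N}` centralises `(Δ^tp_{Y_N})^Θ` modulo
`N·(Δ^tp_Y)^Θ`»), is a THEOREM at every theta setting carrying the origin predicates already consumed by the K3 end-knits:
* **`ThetaSetting.hcen_of_tate`** — from the guard `IsEtThOrigin`, the closedness binder `hYcl`, clause (a)/(b) of the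
  Tate-module datum at level `N` (abc-iut-w5-d051's `IsTateOrigin`), R2 at level `N` and a cusp inside `Π^tp_Y`:
  for `g ∈ Π^tp_{Y_N}` and `y ∈ Δ^tp_{Y_N}`, `θ(g)θ(y)θ(g)⁻¹θ(y)⁻¹ ∈ N·(Δ^tp_Y)^Θ`.  MECHANISM (print's «`≅ ℤ/Nℤ(1)`»):
  `Δ^tp_{Y_N}` IS the `N`-th-power locus of `(Δ^tp_Y)^ell` (abc-iut-w5-d051's `dtpYN_eq_dtpY_inf_comap_ellPowersY`), so
  `θ(y) = s · θ(t)^N` with `s ∈ Δ_Θ`, `t ∈ Δ^tp_Y` (abc-iut-w5-d187's `exists_eq_mul_pow_of_toEll_mem_ellPowersY`); the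
  Tate twist of `Δ_Θ` (abc-iut-w5-d051's `IsTateOrigin.conj_deltaTheta_tateTwist`) reads `θ(g) s θ(g)⁻¹ = e^N · s` for
  `g ∈ Π^tp_{Y_N}` (its Galois image FIXES `ζ_N`: `mem_GKN_iff`), with `e ∈ Δ_Θ ≤ (Δ^tp_Y)^Θ` (`deltaTheta_le_DtpYTheta`),
  and `N·(Δ^tp_Y)^Θ` is normal (this seat's `thetaPowersY_normal`);
* **`ThetaSetting.hcen_of_origins`** — packaged over `IsEtThOrigin ∧ HasThetaTopology ∧ IsThm16Origin ∧ IsTateOrigin`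
  (`hYcl` from abc-iut-L2-t1's `HasThetaTopology.hYcl`, R2 and the cusp from `IsThm16Origin`);
* **`ThetaSetting.gtpZNFromSplitting_of_exists_of_origins`** — HENCE, at every such setting and granted strong completeness
  of `G_{ℚ_p}` (unconditional Summits-side), the ∀-form `GtpZNFromSplitting D N` follows from print's DEFINITION of `Z_N`
  alone (the ∃-form: SOME lifted splitting cuts out `Π^tp_{Z_N}`), by p470538.
HONEST FRAMING: [EtTh] is refereed; nothing asserted beyond the tree's proofs; the origin predicates are hypotheses inhabited
only at (semi-synthetic) models; nothing here bears on [IUTchIII] Cor. 3.12; typed ≠ proved.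
-/

noncomputable section

namespace Literature.AnabelianGeometry.EtaleTheta

open Literature.AnabelianGeometry.SemiGraphs Literature.AnabelianGeometry.AbsoluteAnabelian Thm16Sub

namespace ThetaSetting

variable {p : ℕ} [Fact p.Prime] {D : ThetaSetting p}

/-- **`hcen` from the Tate-module datum at level `N`** («`Δ_Θ ⊗ ℤ/Nℤ ≅ ℤ/Nℤ(1)` central in `(Π^tp_{Y_N})^Θ/N·(Δ^tp_Y)^Θ`»,
p. 14): at a setting with the freeness guard, the closedness binder `hYcl`, a generator `y₁` of `(Δ^tp_Y)^ell` mod `N`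
(clause (a)) on which `G_K` acts through the mod-`N` cyclotomic character (clause (b)), R2 at level `N` and a cusp inside
`Π^tp_Y`, the conjugation action of `Π^tp_{Y_N}` on `(Δ^tp_{Y_N})^Θ` is trivial modulo `N·(Δ^tp_Y)^Θ`.
[cite: MochizukiEtTh2009, §1 p.14] -/
theorem hcen_of_tate (hO : D.IsEtThOrigin)
    (hYcl : (D.DtpY.map D.toHat.toMonoidHom).topologicalClosure ≤
      D.DtpY.map D.toHat.toMonoidHom ⊔ (⁅⁅D.DeltaHat, D.DeltaHat⁆, D.DeltaHat⁆).topologicalClosure)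
    (hT : D.IsTateOrigin) (N : ℕ+) (hR2 : GtpYNFromCusp D N)
    (hcusp : ∃ Dc : Subgroup D.PiTemp, D.IsCuspidalDecompositionGroup Dc ∧ Dc ≤ D.GtpY) :
    ∀ g ∈ D.GtpYN N, ∀ y ∈ D.DtpYN N,
      D.toTheta g * D.toTheta y * (D.toTheta g)⁻¹ * (D.toTheta y)⁻¹ ∈ D.thetaPowersY N := by
  intro g hg y hy
  haveI hPn := D.thetaPowersY_normal N
  obtain ⟨y₁, z, ζ, -, hy₁, -, -, hζ, -, ha, -, -, -⟩ := hT.tate N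
  -- `Δ^tp_{Y_N}` is the `N`-th-power locus: `θ(y) = s · θ(t)^N`, `s ∈ Δ_Θ`, `t ∈ Δ^tp_Y`
  have hy' : y ∈ D.DtpY ⊓ (ellPowersY D N).comap (toEll D) := by
    rw [← D.dtpYN_eq_dtpY_inf_comap_ellPowersY N hy₁ ha hR2 hcusp]; exact hy
  obtain ⟨hyY, hyell⟩ := Subgroup.mem_inf.mp hy'
  obtain ⟨k₁, -, t, ht, hk₁ell, hyeq⟩ := D.exists_eq_mul_pow_of_toEll_mem_ellPowersY hyY hyell
  have hs : D.toTheta k₁ ∈ D.DeltaTheta := hk₁ell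
  have hq : D.toTheta t ^ (N : ℕ) ∈ D.thetaPowersY N := Subgroup.subset_closure ⟨D.toTheta t, ⟨t, ht, rfl⟩, rfl⟩
  -- the Galois image of `g ∈ Π^tp_{Y_N}` fixes `ζ_N`, so the Tate twist of `Δ_Θ` is trivial mod `N`-th powers
  have haug : D.aug g ∈ D.GKN N := by
    have h : D.aug.toMonoidHom g ∈ (D.GtpYN N).map D.aug.toMonoidHom := ⟨g, hg, rfl⟩
    rwa [D.map_aug_GtpYN N] at h
  have hσ1 : D.aug g ζ = ζ ^ 1 := by
    rw [pow_one]; exact ((mem_GKN_iff D N _).1 haug).2.1 ζ hζ.pow_eq_one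
  obtain ⟨e, he, hconj⟩ := hT.conj_deltaTheta_tateTwist hO hYcl N hζ g hσ1 hs
  rw [pow_one] at hconj
  have heN : e ^ (N : ℕ) ∈ D.thetaPowersY N := Subgroup.subset_closure ⟨e, D.deltaTheta_le_DtpYTheta he, rfl⟩
  -- `[θg, s·q] = (θg s θg⁻¹)·(θg q θg⁻¹ q⁻¹)·s⁻¹ = e^N · s (θg q θg⁻¹ q⁻¹) s⁻¹`
  rw [hyeq, map_mul, map_pow]
  have key : D.toTheta g * (D.toTheta k₁ * D.toTheta t ^ (N : ℕ)) * (D.toTheta g)⁻¹ *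
        (D.toTheta k₁ * D.toTheta t ^ (N : ℕ))⁻¹ =
      D.toTheta g * D.toTheta k₁ * (D.toTheta g)⁻¹ *
        (D.toTheta g * D.toTheta t ^ (N : ℕ) * (D.toTheta g)⁻¹ * (D.toTheta t ^ (N : ℕ))⁻¹) * (D.toTheta k₁)⁻¹ := by
    group
  rw [key, hconj, mul_assoc (e ^ (N : ℕ)) (D.toTheta k₁), mul_assoc (e ^ (N : ℕ))]
  exact mul_mem heN (hPn.conj_mem _ (mul_mem (hPn.conj_mem _ hq _) (inv_mem hq)) _)

/-- **`hcen` AT EVERY JOINT ORIGIN**: at a theta setting with `IsEtThOrigin`, `HasThetaTopology`, `IsThm16Origin` (R2 ∀N,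
the cusp of `X^log` inside `Π^tp_Y`) and `IsTateOrigin` (the Tate-module clause ∀N), `Π^tp_{Y_N}` centralises
`(Δ^tp_{Y_N})^Θ` modulo `N·(Δ^tp_Y)^Θ` for EVERY `N` — the binder `hcen` of the root uniqueness theorem and of abc-iut-L2-t1's
K3 end-knit v6 is a theorem of the origin predicates. [cite: MochizukiEtTh2009, §1 p.14] -/
theorem hcen_of_origins (hO : D.IsEtThOrigin) (hTop : D.HasThetaTopology) (h16 : D.IsThm16Origin)
    (hT : D.IsTateOrigin) (N : ℕ+) :
    ∀ g ∈ D.GtpYN N, ∀ y ∈ D.DtpYN N,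
      D.toTheta g * D.toTheta y * (D.toTheta g)⁻¹ * (D.toTheta y)⁻¹ ∈ D.thetaPowersY N :=
  hcen_of_tate hO hTop.hYcl hT N (h16.gtpYN_fromCusp N) h16.exists_cuspidal_le_GtpY

/-- **The ∀-form `GtpZNFromSplitting` from print's DEFINITION of `Z_N` at every joint origin**: granted strong completeness
of `G_{ℚ_p}`, at a setting with the four origin predicates, if SOME lifted splitting over `G_{K_N}` cuts out `Π^tp_{Z_N}` then
EVERY lifted splitting does (this seat's `gtpZNFromSplitting_of_exists_of_stronglyComplete`, p470538, with `hcen` now a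
theorem). [cite: MochizukiEtTh2009, §1 p.14] -/
theorem gtpZNFromSplitting_of_exists_of_origins (hO : D.IsEtThOrigin) (hTop : D.HasThetaTopology)
    (h16 : D.IsThm16Origin) (hT : D.IsTateOrigin)
    (hsc : ∀ U : Subgroup (GQp p), U.FiniteIndex → IsOpen (U : Set (GQp p))) (N : ℕ+)
    (hex : ∃ s₀ : ↥(D.GKN N) → D.GtpTheta, D.IsThetaSplittingAt N s₀ ∧
      ∀ g : D.PiTemp, g ∈ D.GtpZN N ↔ g ∈ D.GtpYN N ∧ ∃ h : D.aug g ∈ D.GJN N,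
        D.toTheta g * (s₀ ⟨D.aug g, D.GJN_le_GKN N h⟩)⁻¹ ∈ D.thetaPowersY N) :
    D.GtpZNFromSplitting N :=
  D.gtpZNFromSplitting_of_exists_of_stronglyComplete hsc (hcen_of_origins hO hTop h16 hT N) hex

/-- **Any two lifted splittings agree on `G_{J_N}` at a joint origin** (the uniqueness sentence itself, p. 14).
[cite: MochizukiEtTh2009, §1 p.14] -/
theorem splittings_agree_of_exists_of_origins (hO : D.IsEtThOrigin) (hTop : D.HasThetaTopology)
    (h16 : D.IsThm16Origin) (hT : D.IsTateOrigin)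
    (hsc : ∀ U : Subgroup (GQp p), U.FiniteIndex → IsOpen (U : Set (GQp p))) (N : ℕ+)
    (hex : ∃ s₀ : ↥(D.GKN N) → D.GtpTheta, D.IsThetaSplittingAt N s₀ ∧
      ∀ g : D.PiTemp, g ∈ D.GtpZN N ↔ g ∈ D.GtpYN N ∧ ∃ h : D.aug g ∈ D.GJN N,
        D.toTheta g * (s₀ ⟨D.aug g, D.GJN_le_GKN N h⟩)⁻¹ ∈ D.thetaPowersY N)
    {s s' : ↥(D.GKN N) → D.GtpTheta} (hs : D.IsThetaSplittingAt N s) (hs' : D.IsThetaSplittingAt N s')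
    {σ : GQp p} (hσ : σ ∈ D.GJN N) :
    s ⟨σ, D.GJN_le_GKN N hσ⟩ * (s' ⟨σ, D.GJN_le_GKN N hσ⟩)⁻¹ ∈ D.thetaPowersY N :=
  D.splittings_agree_of_exists_of_stronglyComplete hsc (hcen_of_origins hO hTop h16 hT N) hex hs hs' hσ

end ThetaSetting

end Literature.AnabelianGeometry.EtaleTheta

end
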